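import Mathlib
import Literature.MathematicalPhysics.QuantumFieldTheory.Balaban1983to89.T4AveragingDeficitWall
import Literature.MathematicalPhysics.QuantumFieldTheory.Balaban1983to89.B7Prop1Local

/-!
# T4AveragingDeficitWallLocal — LOCALITY of Bałaban's average (42) makes the derivative in the typed NE3 wall (β) WINDOW-INDEPENDENT: the influence window of a support, (β) ⇔ its single-window form ⇔ (for `a₀ ≤ c₂′`) a bound on ONE real number `(d/ds)|₀ 𝓓_{W(S)}(V e^{sψ})` per datum; `ClaimBeta ⇔ ClaimBetaDeriv`

HONEST FRAMING (cell `pub-balaban`, T4-DAG PAGE 1; companion of `T4AveragingDeficitWall` v1.1, same seat NE3 = U1 (b),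
lineage `b2b-balaban-t4-ne3-p2`, gen 5, third node).  The cell's T4 target is the finite-torus continuum limit of the
unit-scale averaged loop expectations — NOT infinite volume, NO mass gap, NOT the Clay problem, NOT summit progress.
`T4AveragingDeficitWall` TYPED the one analytic input of the NE3 energy route, CLAIM β (record Appendix β §0, GAPS
G-ne3p2-1), as `DeficitDerivWall` (β) / `DeficitValueWall` (β′) / `ClaimBeta` over Bałaban's own non-linear, non-abelian
average `B7Prop1Explicit.bavg` ((15)/(42)), with the derivative entering (β) as a `HasDerivAt` HYPOTHESIS on a window
pair `W` and the bound asserted `∀ᶠ W in atTop` ("for all sufficiently large finite windows").  Its header deferred ONE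
structural point to prose: «for a finitely supported `ψ` only finitely many terms of `𝓓_W(V e^{sψ})` depend on `s`
(locality of (42) …), so the derivative is eventually window-independent» (listed under NOT CLAIMED there).  THIS FILE
KERNEL-PROVES IT from the tree's printed-locality module `B7Prop1Local` (B7 p. 24 «this definition is local in the sense
that `Ū^k_c` … depends only on the bond variables `U_b` for `b ⊂ B^k(c₋) ∪ B^k(c₊)`», p. 25 «the contours `Γ_{c,x}` are
contained in `Δ(p′)`» — kernel form `B7Prop1Local.cplaq_bavg_congr`), and draws the consequence for the SHAPE of the
wall: (β) is equivalent to its SINGLE-WINDOW form `DeficitDerivWallAt` (the same bound for the derivative of the deficit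
on the explicit finite INFLUENCE WINDOW `inflWindow L S` of the support — no filter), and, in the printed small-field
regime `a₀ ≤ c₂′ = 1/(512(d+1)(d+4)L²)` of B7 Prop. 1 where §8 of the companion certified differentiability, to the
PLAIN-DERIVATIVE form `DeficitDerivBoundAt` (a bound on the real number `deriv (s ↦ 𝓓_{W(S)}(V e^{sψ})) 0`, no
hypothesis on `D` at all); consequently `ClaimBeta d N L ⇔ ClaimBetaDeriv d N L` (`N, L ≥ 1`).  So the EXACT MISSING
INEQUALITY of the NE3 energy route now has a filter-free, hypothesis-free kernel form: constants `C ≥ 0`,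
`0 < a₀ ≤ c₂′`, `R ∈ ℕ` such that for every unitary `V` with `sup |V(∂p′) − 1| ≤ a ≤ a₀` and every skew, `S`-supported
`ψ`:  `|(d/ds)|₀ 𝓓_{W(S)}(V e^{sψ})| ≤ C (√gradFluxSq √curlSq + a²(dirL1 + curlL1))` (all four sums over `nbhd R S`),
AND (β′).  NOTHING here proves β: `ClaimBeta` / `ClaimBetaDeriv` are asserted nowhere in the package, are hypotheses of
no theorem except the equivalence between them, and carry no citation ([analysis] content = Appendix β §3–§6).  NE3 is
COND-free (no BetaPertH / (B) / (B^μ)).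

CITATION HEADER (lean-in-tree rule 2026-08-18).  No sentence of any paper is used as a hypothesis, and the manuscripts
under audit are not cited for any disputed step; every statement of this file is [folklore] bookkeeping or a
kernel-checked identity, and the `[cite:]` tags mark the printed LOCALITY SENTENCES whose kernel form (the tree
theorem `B7Prop1Local.cplaq_bavg_congr`, itself kernel-proved, not quoted) is USED BY NAME.  Source of those sentences:
T. Bałaban, *Averaging operations for lattice gauge theories*, Commun. Math. Phys. **98** (1985) 17–51
[Balaban1985Averaging] («B7»), p. 24 (sentence after (43)) and p. 25 (line after (46)); the quotations above are
carried verbatim from the header of the companion `B7Prop1Local` (cell unit b2b-balaban-b07, gen 15), which read the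
renders of pp. 24–26 as images.  Companions, used BY NAME: `T4AveragingDeficitWall` (v1.1 p190545: the carriers `Plaq`,
`Bond`, the plaquette variables `chol`/`fhol`, `wt`, `coarseAction`, `fineAction`, `deficit`, `vary`,
`vary_eq_of_eq_zero`, the sums `gradFluxSq`/`curlSq`/`curlL1`/`dirL1`, `nbhd`, `bondSites`, the classes `IsUnitaryCfg`,
`IsSkewDir`, `SupportedOn`, `SmallField`, the walls `DeficitDerivWall`, `DeficitValueWall`, `ClaimBeta`, and §8
`exists_hasDerivAt_deficit_vary`), `B7Prop1Local` (`InBox`, `AgreeOn`, `deltaHi` (= `Δ(p′)` (46)), `cplaq_bavg_congr`,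
`hol_plaqWord_eq`), `B7Prop1Explicit` (`Site`, `e`, `e_apply`, `hol`, `plaqWord`, `bavg`, `cplaq`), Mathlib
(`HasDerivAt.add_const`, `HasDerivAt.deriv`, `deriv_add_const`, `Int.ediv_lt_iff_lt_mul`, `Int.le_ediv_iff_mul_le`,
`Filter.eventually_ge_atTop`, `Filter.Eventually.exists`, `Finset.sum_filter_of_ne`).
[cite: Balaban1985Averaging, p.24 (sentence after (43)), p.25 (line after (46)) (locality of (42) — context; kernel form
= tree `B7Prop1Local.cplaq_bavg_congr`)]

DICTIONARY (in the scale-free setting of the companion: unit fine lattice `ℤ^d`, coarse spacing `L`, coarse plaquette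
`P = (y; μ < ν)` ↔ the `L`-plaquette with lower corner `Ly`, whose averaged variable `V̄(∂P) = chol L V P` depends on `V`
only through the bonds of `Δ(P) = [Ly, Ly + (L−1)𝟙 + Le_μ + Le_ν]` (B7 (46))).  For a finite set `S` of fine bonds:
`coarseInfl L S` = all coarse plaquettes `(y; ·)` with `⌊x_i/L⌋ − 1 ≤ y_i ≤ ⌊x_i/L⌋` for the base point `x` of some bond
of `S` (⊇ those whose `Δ(P)` contains such an `x`); `fineInfl S` = all fine plaquettes `(z; ·)` with `x − 𝟙 ≤ z ≤ x` for
such an `x` (⊇ those one of whose four bonds lies in `S`); `inflWindow L S = (coarseInfl L S, fineInfl S)` =: `W(S)` —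
Appendix β's "`N_η(ψ)` at radius `O(L)`" made explicit for the purpose of differentiation (the `R`-neighbourhoods
`nbhd R` on the right-hand side of (β) are untouched).

WHAT IS PROVED (all [folklore], sorry-free).  §1 defs `coarseInfl`, `fineInfl`, `inflWindow`.  §2 `chol_vary_eq_of_not_mem`
(`V̄_s(∂P) = V̄(∂P)` for `P ∉ coarseInfl L S`, `ψ` supported on `S`, `L ≥ 1` — from `B7Prop1Local.cplaq_bavg_congr`),
`fhol_vary_eq_of_not_mem` (`V_s(∂p′) = V(∂p′)` for `p′ ∉ fineInfl S`).  §3 `deficit_vary_sub_eq` (THE WINDOW SPLIT: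
`𝓓_W(V_s) − 𝓓_W(V) = 𝓓_{W ∩ W(S)}(V_s) − 𝓓_{W ∩ W(S)}(V)` for EVERY window pair `W`), `deficit_vary_eq_add_const`
(for `W ⊇ W(S)`: `𝓓_W(V_s) = 𝓓_{W(S)}(V_s) + const`), `hasDerivAt_deficit_vary_iff` and `deriv_deficit_vary_eq` (THE
DERIVATIVE AT `s = 0` IS WINDOW-INDEPENDENT beyond `W(S)`: same `HasDerivAt` data, same `deriv`).  §4 defs
`DeficitDerivWallAt` (single-window form), `DeficitDerivBoundAt` (plain-derivative form), `ClaimBetaDeriv`; theorems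
`deficitDerivWall_iff_at` ((β) ⇔ single-window form, `L ≥ 1`), `DeficitDerivBoundAt.wallAt`, `deficitDerivWall_iff_deriv`
((β) ⇔ plain-derivative form for `a₀ ≤ c₂′`, `N, L ≥ 1`, using §8 of the companion), `claimBeta_iff_claimBetaDeriv`.

NOT CLAIMED.  β / β′ themselves (`ClaimBeta`, `ClaimBetaDeriv` — [analysis], Appendix β §3–§6, GAPS G-ne3p2-1);
minimality of the influence window (it is a convenient finite superset, not the exact dependence set); differentiability
away from `s = 0`; the `E′`-norm packaging, periodisation, the rescaling dictionary, gauge covariance, anything about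
minimisers, B11's `H_k`, Appendix ML, or NE3 (all as in the companion's NOT CLAIMED).  Intended range `2 ≤ L`, `2 ≤ d`;
the theorems assume only what they state (`1 ≤ L`, `Nonempty n` where §8 is used).  Record: HOME/t4/T4-EST-NE3-P2.md
v1.25 §0 (u), Appendix β v0.12 §6.  Version: v1 p190671; v1.1 (this file): DOCSTRING-ONLY fix of §2 `chol_vary_eq_of_not_mem`
(the p. 24 locality sentence quoted with its ellipsis and `k = 1` marked; XREAD pv18-g23 D-1); no declaration changed.
-/

set_option autoImplicit false

open scoped BigOperators Matrix.Norms.L2Operator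
open NormedSpace Finset Filter

namespace Literature.MathematicalPhysics.QuantumFieldTheory.Balaban1983to89.T4AveragingDeficitWallLocal

open B7Prop1Explicit B7Prop2Explicit B7Prop1Local MatrixLog UnitaryModel
open T4AveragingDeficitWall hiding Site

noncomputable section

variable {d : ℕ} {n : Type*} [Fintype n] [DecidableEq n]

/-- Sites of the unit lattice `ℤ^d` (= `B7Prop1Explicit.Site d` = `T4AveragingDeficitWall.Site d`; restated because the
bare name would otherwise resolve to the finite-torus `Setup.Site` of the enclosing namespace). [folklore] -/
abbrev Site (d : ℕ) : Type := Fin d → ℤ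

/-- Plaquettes `(z; μ < ν)` of the companion (`T4AveragingDeficitWall.Plaq`; same remark). [folklore] -/
abbrev Plaq (d : ℕ) : Type := T4AveragingDeficitWall.Plaq d


/-! ## §1 The influence window of a finite set of fine bonds -/

/-- The COARSE INFLUENCE SET of a set of fine bonds `S`: all coarse plaquettes `P = (y; μ < ν)` whose box `Δ(P)`
(B7 (46): `[Ly, Ly + (L−1)𝟙 + Le_μ + Le_ν]`, tree `B7Prop1Local.deltaHi`) can contain the base point of a bond of `S`
(coordinatewise `x_i/L − 1 ≤ y_i ≤ x_i/L`). [folklore] -/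
def coarseInfl (L : ℕ) (S : Finset (Bond d)) : Finset (Plaq d) :=
  (S.biUnion fun b => Finset.Icc (fun i => b.1 i / (L : ℤ) - 1) (fun i => b.1 i / (L : ℤ))) ×ˢ Finset.univ

/-- The FINE INFLUENCE SET of `S`: all fine plaquettes `p′ = (z; μ < ν)` with `x − 𝟙 ≤ z ≤ x` for the base point `x`
of some bond of `S` (these contain every plaquette one of whose four bonds lies in `S`). [folklore] -/
def fineInfl (S : Finset (Bond d)) : Finset (Plaq d) :=
  (S.biUnion fun b => Finset.Icc (b.1 - fun _ => (1 : ℤ)) b.1) ×ˢ Finset.univ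

/-- THE INFLUENCE WINDOW of a support `S`: (coarse, fine) influence sets. [folklore] -/
def inflWindow (L : ℕ) (S : Finset (Bond d)) : Finset (Plaq d) × Finset (Plaq d) := (coarseInfl L S, fineInfl S)

/-! ## §2 Locality of the two plaquette variables along `V e^{sψ}` (B7 p. 24 / p. 25 = tree `B7Prop1Local`) -/

/-- **LOCALITY OF THE AVERAGED PLAQUETTE VARIABLE** (B7 p. 24 «`Ū^k_c` … depends only on the bond variables `U_b`
for `b ⊂ B^k(c₋) ∪ B^k(c₊)`», here `k = 1`; p. 25 «the contours `Γ_{c,x}` are contained in `Δ(p′)`» = tree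
`B7Prop1Local.cplaq_bavg_congr`): perturbing `V` on bonds of `S` does not change `V̄(∂P)` for coarse plaquettes `P`
outside the coarse influence set.
[cite: Balaban1985Averaging, p.24 (sentence after (43)), p.25 (line after (46))] -/
theorem chol_vary_eq_of_not_mem {L : ℕ} (hL : 1 ≤ L) (V : Site d → Fin d → (Matrix n n ℂ)ˣ)
    {ψ : Site d → Fin d → Matrix n n ℂ} {S : Finset (Bond d)} (hS : SupportedOn ψ S) {P : Plaq d}
    (hP : P ∉ coarseInfl L S) (s : ℝ) : chol L (vary V ψ s) P = chol L V P := by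
  have hL0 : (0 : ℤ) < (L : ℤ) := by exact_mod_cast hL
  unfold chol
  refine cplaq_bavg_congr L hL _ (ne_of_lt P.2.2) fun x κ hx _ => ?_
  by_cases hmem : (x, κ) ∈ S
  · exfalso
    refine hP (Finset.mem_product.2 ⟨Finset.mem_biUnion.2 ⟨(x, κ), hmem, Finset.mem_Icc.2 ⟨fun i => ?_, fun i => ?_⟩⟩,
      Finset.mem_univ _⟩)
    · have h2 := (hx i).2
      simp only [deltaHi, Pi.smul_apply, smul_eq_mul] at h2
      have h3 : x i < (P.1 i + 2) * (L : ℤ) := by split_ifs at h2 <;> linarith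
      have h4 : x i / (L : ℤ) < P.1 i + 2 := (Int.ediv_lt_iff_lt_mul hL0).2 h3
      show x i / (L : ℤ) - 1 ≤ P.1 i
      omega
    · have h1 := (hx i).1
      simp only [Pi.smul_apply, smul_eq_mul] at h1
      show P.1 i ≤ x i / (L : ℤ)
      exact (Int.le_ediv_iff_mul_le hL0).2 (by linarith)
  · exact vary_eq_of_eq_zero V (hS x κ hmem) s

/-- LOCALITY OF THE FINE PLAQUETTE VARIABLE: perturbing `V` on bonds of `S` does not change `V(∂p′)` for fine
plaquettes outside the fine influence set. [folklore] -/
theorem fhol_vary_eq_of_not_mem (V : Site d → Fin d → (Matrix n n ℂ)ˣ) {ψ : Site d → Fin d → Matrix n n ℂ}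
    {S : Finset (Bond d)} (hS : SupportedOn ψ S) {p : Plaq d} (hp : p ∉ fineInfl S) (s : ℝ) :
    fhol (vary V ψ s) p = fhol V p := by
  have key : ∀ (z : Site d) (κ : Fin d), (∀ i, z i - 1 ≤ p.1 i ∧ p.1 i ≤ z i) → vary V ψ s z κ = V z κ := by
    intro z κ hz
    by_cases hmem : (z, κ) ∈ S
    · exfalso
      refine hp (Finset.mem_product.2 ⟨Finset.mem_biUnion.2 ⟨(z, κ), hmem, Finset.mem_Icc.2 ⟨fun i => ?_, fun i => ?_⟩⟩,
        Finset.mem_univ _⟩)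
      · simpa only [Pi.sub_apply] using (hz i).1
      · exact (hz i).2
    · exact vary_eq_of_eq_zero V (hS z κ hmem) s
  unfold fhol
  rw [hol_plaqWord_eq, hol_plaqWord_eq, key p.1 _ fun i => ⟨by omega, le_rfl⟩,
    key (p.1 + e _) _ fun i => ?_, key (p.1 + e _) _ fun i => ?_, key p.1 _ fun i => ⟨by omega, le_rfl⟩]
  all_goals simp only [Pi.add_apply, e_apply]; split_ifs <;> omega

/-! ## §3 The window split and the eventual window-independence of the deficit's `s`-dependence -/

/-- THE WINDOW SPLIT: the `s`-dependence of the deficit on any window pair `W` is carried by `W ∩` the influence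
window. [folklore] -/
theorem deficit_vary_sub_eq {L : ℕ} (hL : 1 ≤ L) (V : Site d → Fin d → (Matrix n n ℂ)ˣ)
    {ψ : Site d → Fin d → Matrix n n ℂ} {S : Finset (Bond d)} (hS : SupportedOn ψ S)
    (W : Finset (Plaq d) × Finset (Plaq d)) (s : ℝ) :
    deficit L (vary V ψ s) W - deficit L V W
      = deficit L (vary V ψ s) (W.1 ∩ coarseInfl L S, W.2 ∩ fineInfl S)
        - deficit L V (W.1 ∩ coarseInfl L S, W.2 ∩ fineInfl S) := by
  have e1 : ∀ T : Finset (Plaq d) × Finset (Plaq d), deficit L (vary V ψ s) T - deficit L V T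
      = (L : ℝ) ^ ((d : ℤ) - 4) * ∑ P ∈ T.1, (wt (chol L (vary V ψ s) P) - wt (chol L V P))
        - ∑ p ∈ T.2, (wt (fhol (vary V ψ s) p) - wt (fhol V p)) := by
    intro T
    simp only [deficit, coarseAction, fineAction, Finset.sum_sub_distrib]
    ring
  have hc : ∑ P ∈ W.1 ∩ coarseInfl L S, (wt (chol L (vary V ψ s) P) - wt (chol L V P))
      = ∑ P ∈ W.1, (wt (chol L (vary V ψ s) P) - wt (chol L V P)) := by
    rw [← Finset.filter_mem_eq_inter, Finset.sum_filter_of_ne]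
    intro P _ hne
    by_contra hP
    exact hne (by rw [chol_vary_eq_of_not_mem hL V hS hP s, sub_self])
  have hf : ∑ p ∈ W.2 ∩ fineInfl S, (wt (fhol (vary V ψ s) p) - wt (fhol V p))
      = ∑ p ∈ W.2, (wt (fhol (vary V ψ s) p) - wt (fhol V p)) := by
    rw [← Finset.filter_mem_eq_inter, Finset.sum_filter_of_ne]
    intro p _ hne
    by_contra hp
    exact hne (by rw [fhol_vary_eq_of_not_mem V hS hp s, sub_self])
  rw [e1, e1, hc, hf]

/-- **EVENTUAL WINDOW-INDEPENDENCE**: for every window pair containing the influence window, the perturbed deficit is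
the perturbed deficit ON THE INFLUENCE WINDOW plus an `s`-independent constant. [folklore] -/
theorem deficit_vary_eq_add_const {L : ℕ} (hL : 1 ≤ L) (V : Site d → Fin d → (Matrix n n ℂ)ˣ)
    {ψ : Site d → Fin d → Matrix n n ℂ} {S : Finset (Bond d)} (hS : SupportedOn ψ S)
    {W : Finset (Plaq d) × Finset (Plaq d)} (hW : inflWindow L S ≤ W) (s : ℝ) :
    deficit L (vary V ψ s) W
      = deficit L (vary V ψ s) (inflWindow L S) + (deficit L V W - deficit L V (inflWindow L S)) := by
  have h := deficit_vary_sub_eq hL V hS W s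
  have hW1 : coarseInfl L S ⊆ W.1 := hW.1
  have hW2 : fineInfl S ⊆ W.2 := hW.2
  rw [Finset.inter_eq_right.2 hW1, Finset.inter_eq_right.2 hW2] at h
  have h' : deficit L (vary V ψ s) (coarseInfl L S, fineInfl S) = deficit L (vary V ψ s) (inflWindow L S) := rfl
  have h'' : deficit L V (coarseInfl L S, fineInfl S) = deficit L V (inflWindow L S) := rfl
  rw [h', h''] at h
  linarith

/-- **THE DERIVATIVE IN (β) IS WINDOW-INDEPENDENT**: on every window pair containing the influence window of the
support, `s ↦ 𝓓_W(V e^{sψ})` has derivative `D` at `0` iff `s ↦ 𝓓_{W(S)}(V e^{sψ})` does, `W(S)` the influence window.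
[folklore] -/
theorem hasDerivAt_deficit_vary_iff {L : ℕ} (hL : 1 ≤ L) (V : Site d → Fin d → (Matrix n n ℂ)ˣ)
    {ψ : Site d → Fin d → Matrix n n ℂ} {S : Finset (Bond d)} (hS : SupportedOn ψ S)
    {W : Finset (Plaq d) × Finset (Plaq d)} (hW : inflWindow L S ≤ W) (D : ℝ) :
    HasDerivAt (fun s : ℝ => deficit L (vary V ψ s) W) D 0
      ↔ HasDerivAt (fun s : ℝ => deficit L (vary V ψ s) (inflWindow L S)) D 0 := by
  have hfun : (fun s : ℝ => deficit L (vary V ψ s) W)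
      = fun s : ℝ => deficit L (vary V ψ s) (inflWindow L S) + (deficit L V W - deficit L V (inflWindow L S)) :=
    funext fun s => deficit_vary_eq_add_const hL V hS hW s
  rw [hfun]
  constructor
  · intro h
    have h2 := h.add_const (-(deficit L V W - deficit L V (inflWindow L S)))
    simpa only [add_neg_cancel_right] using h2
  · intro h
    exact h.add_const _

/-- The derivative VALUE is window-independent beyond the influence window. [folklore] -/
theorem deriv_deficit_vary_eq {L : ℕ} (hL : 1 ≤ L) (V : Site d → Fin d → (Matrix n n ℂ)ˣ)
    {ψ : Site d → Fin d → Matrix n n ℂ} {S : Finset (Bond d)} (hS : SupportedOn ψ S)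
    {W : Finset (Plaq d) × Finset (Plaq d)} (hW : inflWindow L S ≤ W) :
    deriv (fun s : ℝ => deficit L (vary V ψ s) W) 0 = deriv (fun s : ℝ => deficit L (vary V ψ s) (inflWindow L S)) 0 := by
  have hfun : (fun s : ℝ => deficit L (vary V ψ s) W)
      = fun s : ℝ => deficit L (vary V ψ s) (inflWindow L S) + (deficit L V W - deficit L V (inflWindow L S)) :=
    funext fun s => deficit_vary_eq_add_const hL V hS hW s
  rw [hfun, deriv_add_const]

/-! ## §4 (β) ⇔ its single-window form ⇔ (in the printed regime `a₀ ≤ c₂′`) its plain-derivative form;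
`ClaimBeta ⇔ ClaimBetaDeriv` -/

variable (d n) in
/-- THE SINGLE-WINDOW FORM OF (β): the same bound, for the derivative of the deficit ON THE INFLUENCE WINDOW of the
support — no filter, no eventuality. [folklore] -/
def DeficitDerivWallAt (L : ℕ) (C a₀ : ℝ) (R : ℕ) : Prop :=
  ∀ V : Site d → Fin d → (Matrix n n ℂ)ˣ, IsUnitaryCfg V → ∀ a : ℝ, 0 ≤ a → a ≤ a₀ → SmallField V a →
    ∀ (ψ : Site d → Fin d → Matrix n n ℂ) (S : Finset (Bond d)), IsSkewDir ψ → SupportedOn ψ S →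
      ∀ D : ℝ, HasDerivAt (fun s : ℝ => deficit L (vary V ψ s) (inflWindow L S)) D 0 →
        |D| ≤ C * (Real.sqrt (gradFluxSq V (nbhd R (bondSites S))) * Real.sqrt (curlSq V ψ (nbhd R (bondSites S)))
          + a ^ 2 * (dirL1 ψ (nbhd R (bondSites S)) + curlL1 V ψ (nbhd R (bondSites S))))

/-- **(β) ⇔ ITS SINGLE-WINDOW FORM** (`L ≥ 1`): the eventuality over window pairs in `DeficitDerivWall` is exactly
evaluation at the influence window — the typed wall is a bound on ONE number per datum `(V, ψ)`. [folklore] -/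
theorem deficitDerivWall_iff_at {L : ℕ} (hL : 1 ≤ L) (C a₀ : ℝ) (R : ℕ) :
    DeficitDerivWall d n L C a₀ R ↔ DeficitDerivWallAt d n L C a₀ R := by
  constructor
  · intro h V hV a ha haa hVa ψ S hψ hS D hD
    obtain ⟨W, hWD, hWge⟩ := ((h V hV a ha haa hVa ψ S hψ hS).and (eventually_ge_atTop (inflWindow L S))).exists
    exact hWD D ((hasDerivAt_deficit_vary_iff hL V hS hWge D).2 hD)
  · intro h V hV a ha haa hVa ψ S hψ hS
    filter_upwards [eventually_ge_atTop (inflWindow L S)] with W hW D hD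
    exact h V hV a ha haa hVa ψ S hψ hS D ((hasDerivAt_deficit_vary_iff hL V hS hW D).1 hD)

variable (d n) in
/-- THE PLAIN-DERIVATIVE FORM OF (β): the bound on the NUMBER `(d/ds)|₀ 𝓓_{W(S)}(V e^{sψ})` (Mathlib `deriv`), for
every admissible datum. [folklore] -/
def DeficitDerivBoundAt (L : ℕ) (C a₀ : ℝ) (R : ℕ) : Prop :=
  ∀ V : Site d → Fin d → (Matrix n n ℂ)ˣ, IsUnitaryCfg V → ∀ a : ℝ, 0 ≤ a → a ≤ a₀ → SmallField V a →
    ∀ (ψ : Site d → Fin d → Matrix n n ℂ) (S : Finset (Bond d)), IsSkewDir ψ → SupportedOn ψ S →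
      |deriv (fun s : ℝ => deficit L (vary V ψ s) (inflWindow L S)) 0|
        ≤ C * (Real.sqrt (gradFluxSq V (nbhd R (bondSites S))) * Real.sqrt (curlSq V ψ (nbhd R (bondSites S)))
          + a ^ 2 * (dirL1 ψ (nbhd R (bondSites S)) + curlL1 V ψ (nbhd R (bondSites S))))

/-- The plain-derivative form implies the single-window form (any `a₀`): a `HasDerivAt` datum IS the derivative.
[folklore] -/
theorem DeficitDerivBoundAt.wallAt {L : ℕ} {C a₀ : ℝ} {R : ℕ} (h : DeficitDerivBoundAt d n L C a₀ R) :
    DeficitDerivWallAt d n L C a₀ R := by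
  intro V hV a ha haa hVa ψ S hψ hS D hD
  rw [← hD.deriv]
  exact h V hV a ha haa hVa ψ S hψ hS

/-- **(β) ⇔ ITS PLAIN-DERIVATIVE FORM IN THE PRINTED REGIME** `a₀ ≤ c₂′ = 1/(512(d+1)(d+4)L²)` (B7 Prop. 1; by §8
the derivative then exists for every admissible datum): combining §8 (`exists_hasDerivAt_deficit_vary`) and §9
(`deficitDerivWall_iff_at`), the typed wall (β) is exactly the assertion that ONE REAL NUMBER per datum,
`(d/ds)|₀ 𝓓_{W(S)}(V e^{sψ})`, obeys (★). [folklore] -/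
theorem deficitDerivWall_iff_deriv [Nonempty n] {L : ℕ} (hL : 1 ≤ L) {C a₀ : ℝ} {R : ℕ}
    (ha₀ : 512 * (d + 1) * (d + 4) * (L : ℝ) ^ 2 * a₀ ≤ 1) :
    DeficitDerivWall d n L C a₀ R ↔ DeficitDerivBoundAt d n L C a₀ R := by
  rw [deficitDerivWall_iff_at hL]
  refine ⟨fun h V hV a ha haa hVa ψ S hψ hS => ?_, DeficitDerivBoundAt.wallAt⟩
  have hsmall : 512 * (d + 1) * (d + 4) * (L : ℝ) ^ 2 * a ≤ 1 :=
    (mul_le_mul_of_nonneg_left haa (by positivity)).trans ha₀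
  obtain ⟨D, hD⟩ := exists_hasDerivAt_deficit_vary L hL hV ha hsmall hVa ψ (inflWindow L S)
  rw [hD.deriv]
  exact h V hV a ha haa hVa ψ S hψ hS D hD

variable (d n) in
/-- CLAIM (β)+(β′) IN PLAIN-DERIVATIVE FORM (asserted nowhere): constants `C ≥ 0`, `0 < a₀ ≤ c₂′`, `R` with the
plain-derivative bound and the value bound. [folklore] -/
def ClaimBetaDeriv (L : ℕ) : Prop :=
  ∃ C a₀ : ℝ, ∃ R : ℕ, 0 ≤ C ∧ 0 < a₀ ∧ 512 * (d + 1) * (d + 4) * (L : ℝ) ^ 2 * a₀ ≤ 1 ∧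
    DeficitDerivBoundAt d n L C a₀ R ∧ DeficitValueWall d n L C a₀ R

/-- **`ClaimBeta` ⇔ `ClaimBetaDeriv`** (`N ≥ 1`, `L ≥ 1`): the wall typed in v1 with a `HasDerivAt` hypothesis and an
eventuality over windows is EQUIVALENT to the filter-free, hypothesis-free statement about `deriv` on the influence
window (the threshold `a₀` may always be lowered: both walls are monotone in `a₀`). [folklore] -/
theorem claimBeta_iff_claimBetaDeriv [Nonempty n] {L : ℕ} (hL : 1 ≤ L) : ClaimBeta d n L ↔ ClaimBetaDeriv d n L := by
  have hK : (0 : ℝ) < 512 * (d + 1) * (d + 4) * (L : ℝ) ^ 2 := by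
    have : (1 : ℝ) ≤ (L : ℝ) := by exact_mod_cast hL
    positivity
  constructor
  · rintro ⟨C, a₀, R, hC, ha₀, -, hβ, hβ'⟩
    -- lower the threshold to `a₁ = min a₀ c₂′`
    set a₁ : ℝ := min a₀ (1 / (512 * (d + 1) * (d + 4) * (L : ℝ) ^ 2)) with ha₁_def
    have ha₁a₀ : a₁ ≤ a₀ := min_le_left _ _
    have ha₁K : 512 * (d + 1) * (d + 4) * (L : ℝ) ^ 2 * a₁ ≤ 1 := by
      have h1 : a₁ ≤ 1 / (512 * (d + 1) * (d + 4) * (L : ℝ) ^ 2) := min_le_right _ _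
      calc 512 * (d + 1) * (d + 4) * (L : ℝ) ^ 2 * a₁
          ≤ 512 * (d + 1) * (d + 4) * (L : ℝ) ^ 2 * (1 / (512 * (d + 1) * (d + 4) * (L : ℝ) ^ 2)) :=
            mul_le_mul_of_nonneg_left h1 hK.le
        _ = 1 := by field_simp
    have hβ₁ : DeficitDerivWall d n L C a₁ R := fun V hV a ha haa hVa ψ S hψ hS =>
      hβ V hV a ha (haa.trans ha₁a₀) hVa ψ S hψ hS
    have hβ'₁ : DeficitValueWall d n L C a₁ R := fun V hV a ha haa hVa Y =>
      hβ' V hV a ha (haa.trans ha₁a₀) hVa Y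
    exact ⟨C, a₁, R, hC, lt_min ha₀ (by positivity), ha₁K, (deficitDerivWall_iff_deriv hL ha₁K).1 hβ₁, hβ'₁⟩
  · rintro ⟨C, a₀, R, hC, ha₀, hK₀, hβ, hβ'⟩
    have ha₀1 : a₀ ≤ 1 := by
      by_contra hlt
      have : (512 * (d + 1) * (d + 4) * (L : ℝ) ^ 2) * 1 < 512 * (d + 1) * (d + 4) * (L : ℝ) ^ 2 * a₀ :=
        mul_lt_mul_of_pos_left (lt_of_not_ge hlt) hK
      have h512 : (1 : ℝ) ≤ 512 * (d + 1) * (d + 4) * (L : ℝ) ^ 2 := by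
        have hL1 : (1 : ℝ) ≤ (L : ℝ) := by exact_mod_cast hL
        have hd0 : (0 : ℝ) ≤ (d : ℝ) := by positivity
        have h1 : (1 : ℝ) ≤ (d : ℝ) + 1 := by linarith
        have h2 : (1 : ℝ) ≤ (d : ℝ) + 4 := by linarith
        have h3 : (1 : ℝ) ≤ (L : ℝ) ^ 2 := one_le_pow₀ hL1
        have h12 : (1 : ℝ) ≤ ((d : ℝ) + 1) * ((d : ℝ) + 4) := one_le_mul_of_one_le_of_one_le h1 h2
        have h123 : (1 : ℝ) ≤ ((d : ℝ) + 1) * ((d : ℝ) + 4) * (L : ℝ) ^ 2 :=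
          one_le_mul_of_one_le_of_one_le h12 h3
        have hrw : (512 : ℝ) * (d + 1) * (d + 4) * (L : ℝ) ^ 2 = 512 * (((d : ℝ) + 1) * ((d : ℝ) + 4) * (L : ℝ) ^ 2) := by
          ring
        rw [hrw]
        linarith
      linarith
    exact ⟨C, a₀, R, hC, ha₀, ha₀1, (deficitDerivWall_iff_deriv hL hK₀).2 hβ, hβ'⟩

end

end Literature.MathematicalPhysics.QuantumFieldTheory.Balaban1983to89.T4AveragingDeficitWallLocal
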